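import Summits.QuantumFields.BalabanUV.T4Continuum.Spine.NE7.QLaCriticalityAxial
import Literature.MathematicalPhysics.QuantumFieldTheory.Balaban1983to89.BlockAveraging

/-!
# Spine/NE7/QLaAbelianBlockModel — Bałaban's exp-mean-log block averaging [Balaban1987RG1] (0.4) in the ABELIAN Lie-algebra
# model with the exact logarithm is a genuine `Setup.Averaging` on the tree's torus (covariance, locality, `AvgFlat`); the
# torus geometry of its loops (staircase and transported-bond endpoints, column multiplicity `L` of the transported bonds)

Cell `pub-balaban-gaps` (YM blitz Y1, track G2, seat `ne7`, generation 4); text of record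
`run/shared/lean/pub/pub-balaban-gaps/ne/NE7.md` v4 §4quinquies, census rows R32–R40.  Ninth `Spine/NE7/` file; its companion
`QLaAbelianBlockContraction` (tenth) proves NE1a-STEP with `θ = L^{1−d}` for this averaging and the second-order loop defect
bound with every hypothesis discharged (split for the 400-line rule).

WHY.  Generation 3 closed NODE S = (QL-a)∣_{U=1} by criticality (`QLaCriticality`, p342645) modulo the ONE-STEP hypothesis
shape NE1a-STEP = `T4AvgDerivBound.AvgStepContraction av dom θ` and certified non-vacuity of the composite shape
`LoopDefectBound` only for the axial DECIMATION average (`QLaCriticalityAxial`, p343210), where `θ = 1` — and with `θ = 1` the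
NODE-S exponent is `a = θ²·Λ = L⁴ > 1`, i.e. the letter `a < 1` of (QL-a) FAILS in that instance.  A contraction `θ < 1` needs a
genuine AVERAGE over the `L^d` block sites.  This file and its companion supply the first such inhabitant in the tree: the (0.4)
block averaging of [Balaban1987RG1] p. 253 — «Ū(c) = M(U, c) = exp[i Σ_{x∈B(c₋)} L^{-d} Σ_{Γ∈G(c₋,x)} 1/|G(c₋,x)| Σ_{Γ′∈G(c₊,x′)}
1/|G(c₊,x′)| × (1/i) log U(Γ ∪ [x,x′] ∪ (−Γ′) ∪ (−c))] U(c)», whose loop words, index set and loop variables are the tree's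
`BlockAveraging.loopWord` ∕ `Idx` ∕ `loopHol` (unit b2b-balaban-pv26) — evaluated in the ABELIAN LIE-ALGEBRA MODEL `LinPhase` (§1:
real phases under addition, `dist1 = |ph|`, `reTr = cos ph`; the linearised model of [Balaban1985Averaging] (14), in which the
`pub-balaban` cell's records `t4/T4-EST-O3c*.md` compute), where `(1/i) log` IS the phase and needs no small-field guard
(contrast `BlockAveraging.avgFun ℰ`: any group, axiomatic small-loop average `ℰ`, guarded by `Small`).  Results (all [folklore],
kernel-checked, 0 sorry):
* §1 `LinPhase` is a `GaugeGroup`; CRITICALITY `ReTrCrit LinPhase ½` = `1 − cos x ≤ x²/2` (`LinPhase.reTrCrit`).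
* §2 transport phases are additive and LINEAR in the configuration (`ph_holAt_quot`), bounded by `ℓ¹` mass (`abs_ph_holAt_le`).
* §3 torus geometry of the (0.4) loops in the tree's centred labelling: the staircase `Γ ∈ G(y,x)` from `emb y` ends at
  `x = blockSite y r` (`walkEnd_emb_stairWord`); the transported bond `[x,x′]` ends at `blockSite (y+e_μ) r`
  (`walkEnd_blockSite_replicate`, wrap-around by `AveragingRT.cast_succ_mul_L`); the phase along it is the sum over its bonds
  `segBond c r t` (`ph_holAt_replicate`), and `segBond c r t` determines `(c, r)` (`segBond_injective`) — COLUMN MULTIPLICITY `≤ L`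
  per fine bond (`sum_segBond_le`), the count `L·L^{−d} = L^{1−d}` of [Balaban1985Averaging] Prop. 5 (156) read with (138) at the
  flat configuration (cell record `t4/T4-EST-O3cNE1a.md`; `T4AvgJacobianL1.card_segmentFibre_le` is the `ℤ^d` version).
* §4 `linAvg : Averaging P j LinPhase` — (0.4) with the exact logarithm, `Ū(c) = ⟨loopMean U c⟩ · U(c)`: COVARIANCE (B7 (11)) from
  `BlockAveraging.loopHol_gaugeAct` + `AveragingRT.axialAvg_covariant`, LOCALITY from `BlockAveraging.loopHol_local` +
  `axialAvg_local`, `AvgFlat` (`avgFlat_linAvg`).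

CITATIONS (as printed; read by the authors of the tree modules this file consumes, renders named there): [Balaban1987RG1] = T.
Bałaban, CMP 109 (1987) 249–301, (0.3)–(0.4) pp. 252–253 (quoted in `BlockAveraging`); [Balaban1985Averaging] = T. Bałaban, CMP 98
(1985) 17–51, (11)/(14)/(15) p. 19, Prop. 5 (156) p. 42, (138) p. 39 (quoted in `T4AvgDerivBound`, `T4AvgJacobianL1`).  Nothing else
of either paper is used; no statement of the series is re-proved or disputed here.

HONEST FRAMING.  A MODEL INSTANCE: abelian, Lie-algebra valued, no compactness, no small-field domains.  It says NOTHING about the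
non-abelian corrections of [Balaban1985Averaging] (15) (commutators, Props 1–5, the (52)/(158) domains), which remain the located
content of NE1a-STEP for `SU(N)`; nothing of Bałaban's densities, R-operation or (1.100) insert is touched.  (QL-a) NOT IN PRINT
([Balaban1989LargeFieldII] p. 356 defers observables); NE7 NOT proved; spine 0∕9; fixed finite T⁴ — NOT ℝ⁴, NOT infinite volume,
NOT a mass gap, NOT Clay.
-/

noncomputable section

open Finset
open scoped BigOperators

namespace Summit.QuantumFields.BalabanUV.T4Continuum.Spine.NE7

open Literature.MathematicalPhysics.QuantumFieldTheory.Balaban1983to89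
open Literature.MathematicalPhysics.QuantumFieldTheory.Balaban1983to89.T4Continuum
open Literature.MathematicalPhysics.QuantumFieldTheory.Balaban1983to89.T4AvgSensitivity
open Literature.MathematicalPhysics.QuantumFieldTheory.Balaban1983to89.T4AvgDerivBound
open Literature.MathematicalPhysics.QuantumFieldTheory.Balaban1983to89.BlockAveraging (Idx off loopHol loopHol_gaugeAct
  loopHol_local)
open Literature.MathematicalPhysics.QuantumFieldTheory.Balaban1983to89.AveragingRT (axialAvg axialAvg_covariant
  axialAvg_local blockSite_inj cast_succ_mul_L)

/-! ## §1 The abelian Lie-algebra model of the gauge group -/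

/-- THE ABELIAN LIE-ALGEBRA MODEL of the gauge group: a bond variable is a real PHASE `ph` (the logarithm of a `U(1)` bond
variable, with no identification modulo `2π` — the linearised model of [Balaban1985Averaging] (14), in which parallel transport
ADDS phases), `dist1 = |ph|` (the invariant distance to the identity `ph = 0`), `reTr = cos ph` (the `U(1)` loop variable
`Re e^{i·ph}`).  A one-field structure, so that no instance is placed on a Mathlib type. [folklore] -/
@[ext] structure LinPhase : Type where
  /-- the phase -/
  ph : ℝ

namespace LinPhase

/-- The abelian group structure: phases ADD (parallel transport in the Lie-algebra model), written multiplicatively to fit the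
tree's `GaugeGroup` interface. [folklore] -/
instance instCommGroup : CommGroup LinPhase where
  mul a b := ⟨a.ph + b.ph⟩
  one := ⟨0⟩
  inv a := ⟨-a.ph⟩
  mul_assoc a b c := LinPhase.ext (add_assoc a.ph b.ph c.ph)
  one_mul a := LinPhase.ext (zero_add a.ph)
  mul_one a := LinPhase.ext (add_zero a.ph)
  inv_mul_cancel a := LinPhase.ext (neg_add_cancel a.ph)
  mul_comm a b := LinPhase.ext (add_comm a.ph b.ph)

/-- Phases add under multiplication. [folklore] -/
@[simp] theorem mul_ph (a b : LinPhase) : (a * b).ph = a.ph + b.ph := rfl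

/-- The identity has phase `0`. [folklore] -/
@[simp] theorem one_ph : (1 : LinPhase).ph = 0 := rfl

/-- Inversion negates the phase. [folklore] -/
@[simp] theorem inv_ph (a : LinPhase) : a⁻¹.ph = -a.ph := rfl

/-- `LinPhase` as a `GaugeGroup` (the tree's interface `Setup.GaugeGroup`): `dist1 = |ph|`, `reTr = cos ph`; all eleven
interface identities hold (abelian: conjugation is trivial). [folklore] -/
noncomputable instance instGaugeGroup : GaugeGroup LinPhase where
  toGroup := inferInstance
  dist1 g := |g.ph|
  reTr g := Real.cos g.ph
  dist1_nonneg g := abs_nonneg _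
  dist1_one := by simp
  dist1_inv g := by simp
  dist1_conj g h := by
    show |(h * g * h⁻¹).ph| = |g.ph|
    simp only [mul_ph, inv_ph]; ring_nf
  dist1_mul_le g h := by
    show |(g * h).ph| ≤ |g.ph| + |h.ph|
    rw [mul_ph]; exact abs_add_le _ _
  reTr_one := by simp
  reTr_le_one g := Real.cos_le_one _
  reTr_inv g := by
    show Real.cos (g⁻¹).ph = Real.cos g.ph
    rw [inv_ph, Real.cos_neg]
  reTr_conj g h := by
    show Real.cos (h * g * h⁻¹).ph = Real.cos g.ph
    simp only [mul_ph, inv_ph]; ring_nf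

/-- Unfolding: `dist1 g = |g.ph|`. [folklore] -/
@[simp] theorem dist1_eq (g : LinPhase) : dist1 g = |g.ph| := rfl

/-- Unfolding: `reTr g = cos g.ph`. [folklore] -/
@[simp] theorem reTr_eq (g : LinPhase) : reTr g = Real.cos g.ph := rfl

/-- The size of a one-bond change is the absolute phase difference. [folklore] -/
theorem bdist_eq (g h : LinPhase) : bdist g h = |h.ph - g.ph| := by
  rw [bdist_def, dist1_eq, mul_ph, inv_ph, neg_add_eq_sub]

/-- **CRITICALITY IN THE ABELIAN MODEL**: `1 − cos x ≤ x²/2`, i.e. `ReTrCrit LinPhase ½` (the abelian case of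
`QLaCriticality.one_sub_nReTr_le_half_opDist1_sq`; Mathlib's `Real.one_sub_sq_div_two_le_cos`). [folklore] -/
theorem reTrCrit : ReTrCrit LinPhase (1 / 2) := by
  intro g
  show 1 - Real.cos g.ph ≤ 1 / 2 * |g.ph| ^ 2
  rw [sq_abs]
  have h := Real.one_sub_sq_div_two_le_cos (x := g.ph)
  linarith

end LinPhase

open LinPhase

/-! ## §2 Phases of parallel transports: additive, and linear in the configuration -/

section Phases

variable {P : Params} {j : ℕ}

/-- The QUOTIENT configuration `U⁻¹U′` (bondwise): its phases are the phase differences. [folklore] -/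
def quot (U U' : GaugeField P j LinPhase) : GaugeField P j LinPhase := fun b => (U b)⁻¹ * U' b

/-- Phases of the quotient configuration. [folklore] -/
@[simp] theorem quot_ph (U U' : GaugeField P j LinPhase) (b : PBond P j) : (quot U U' b).ph = (U' b).ph - (U b).ph := by
  simp [quot, neg_add_eq_sub]

/-- The total variation of a configuration change is the `ℓ¹` norm of the phase differences. [folklore] -/
theorem tv_eq_sum_abs (U U' : GaugeField P j LinPhase) : tv U U' = ∑ b : PBond P j, |(quot U U' b).ph| := by
  unfold tv
  exact Finset.sum_congr rfl fun b _ => by rw [bdist_eq, quot_ph]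

/-- TRANSPORT IS LINEAR: the phase of the transport of the quotient configuration along any step sequence is the difference
of the phases of the transports (abelian model). [folklore] -/
theorem ph_holAt_quot (U U' : GaugeField P j LinPhase) :
    ∀ γ : List (LStep P j), (holAt (quot U U') γ).ph = (holAt U' γ).ph - (holAt U γ).ph
  | [] => by simp [holAt_nil]
  | s :: γ => by
    rcases s with ⟨b, _ | _⟩ <;> simp [holAt_cons, ph_holAt_quot U U' γ] <;> ring

/-- The phase of a transport is bounded by the `ℓ¹` mass of the phases met. [folklore] -/
theorem abs_ph_holAt_le (U : GaugeField P j LinPhase) :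
    ∀ γ : List (LStep P j), |(holAt U γ).ph| ≤ (γ.map fun s => |(U s.bond).ph|).sum
  | [] => by simp [holAt_nil]
  | s :: γ => by
    rw [holAt_cons, mul_ph, List.map_cons, List.sum_cons]
    refine (abs_add_le _ _).trans (add_le_add ?_ (abs_ph_holAt_le U γ))
    rcases s with ⟨b, _ | _⟩ <;> simp

/-- The trivial configuration transports trivially: phase `0` along every step sequence. [folklore] -/
theorem ph_holAt_one (γ : List (LStep P j)) : (holAt (1 : GaugeField P j LinPhase) γ).ph = 0 := by
  rw [holAt_one γ, one_ph]

end Phases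

/-! ## §3 Torus geometry of the (0.4) loops: the staircase ends at the block site, the transported bond ends in the next
block, the bonds of the transported bond and their column multiplicity `≤ L` -/

section Geometry

variable {P : Params} {j : ℕ}

/-- The staircase `Γ ∈ G(y, x)` of [Balaban1987RG1] p. 252 read from the block centre `emb y` with centred offset `n = off r`
ENDS AT `x = blockSite y r` (tree `netDisp_stairWord` + the centred labelling of `TorusGeometry`). [folklore] -/
theorem walkEnd_emb_stairWord (y : Site P (j + 1)) (σ : Equiv.Perm (Fin P.d)) (r : Fin P.d → Fin P.L) :
    walkEnd (emb y) (stairWord σ (off r)) = Site.blockSite y r := by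
  funext ν
  rw [walkEnd_apply, netDisp_stairWord]
  set h : ℕ := (P.L - 1) / 2 with hh
  simp only [emb, Site.blockSite, off, ← hh]
  push_cast
  ring

/-- `blockSite (y + e_μ) r = blockSite y r + L e_μ` in coordinates (standing range; the wrap-around congruence is
`AveragingRT.cast_succ_mul_L`). [folklore] -/
theorem blockSite_shift_apply (hj : j + 1 ≤ P.m + P.K) (y : Site P (j + 1)) (r : Fin P.d → Fin P.L) (μ ν : Fin P.d) :
    Site.blockSite (y.shift μ) r ν = Site.blockSite y r ν + (if ν = μ then (P.L : ZMod (P.sitesPerDir j)) else 0) := by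
  by_cases hν : ν = μ
  · subst hν
    rw [if_pos rfl]
    have hs : (y.shift ν) ν = y ν + 1 := by simp [Site.shift_apply]
    simp only [Site.blockSite, hs]
    rw [cast_succ_mul_L hj (y ν) (r ν)]
    push_cast
    ring
  · rw [if_neg hν, add_zero]
    simp only [Site.blockSite, Site.shift_apply, if_neg hν]

/-- The straight walk of `n` steps `+e_μ` from `x` ends at `x + n e_μ`. [folklore] -/
theorem walkEnd_replicate_true (x : Site P j) (μ : Fin P.d) (n : ℕ) :
    walkEnd x (List.replicate n (μ, true)) = Function.update x μ (x μ + n) := by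
  funext ν
  rw [walkEnd_apply, T4ReflectionCone.netDisp_replicate]
  by_cases hν : ν = μ
  · subst hν
    simp
  · rw [Function.update_of_ne hν]
    simp [Ne.symm hν]

/-- THE TRANSPORTED BOND `[x, x′]` ENDS IN THE NEXT BLOCK AT THE SAME OFFSET: `blockSite y r + L e_μ = blockSite (y + e_μ) r`
(standing range). [folklore] -/
theorem walkEnd_blockSite_replicate (hj : j + 1 ≤ P.m + P.K) (y : Site P (j + 1)) (r : Fin P.d → Fin P.L) (μ : Fin P.d) :
    walkEnd (Site.blockSite y r) (List.replicate P.L (μ, true)) = Site.blockSite (y.shift μ) r := by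
  rw [walkEnd_replicate_true]
  funext ν
  rw [blockSite_shift_apply hj]
  by_cases hν : ν = μ
  · subst hν
    simp
  · rw [Function.update_of_ne hν, if_neg hν, add_zero]

/-- The `t`-th bond `⟨x + t e_μ, μ⟩` of the transported bond `[x, x′]`, `x = blockSite c₋ r`, `μ` the direction of `c`
([Balaban1987RG1] p. 252 «a contour which is obtained by a parallel transport of c to the point x»). [folklore] -/
def segBond (c : PBond P (j + 1)) (r : Fin P.d → Fin P.L) (t : ℕ) : PBond P j :=
  ⟨Function.update (Site.blockSite c.src r) c.dir (Site.blockSite c.src r c.dir + t), c.dir⟩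

/-- The phase of the transport along `n` steps `+e_μ` from `x` is the SUM of the phases of the bonds `⟨x + t e_μ, μ⟩`,
`t < n` (abelian model). [folklore] -/
theorem ph_holAt_replicate (U : GaugeField P j LinPhase) (x : Site P j) (μ : Fin P.d) :
    ∀ n : ℕ, (holAt U (walk x (List.replicate n (μ, true)))).ph =
      ∑ t ∈ Finset.range n, (U ⟨Function.update x μ (x μ + t), μ⟩).ph
  | 0 => by simp [walk, holAt_nil]
  | n + 1 => by
    rw [List.replicate_succ', walk_append, holAt_append, mul_ph, ph_holAt_replicate U x μ n, Finset.sum_range_succ,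
      walkEnd_replicate_true]
    simp [walk, holAt_cons, holAt_nil]

/-- COLUMN MULTIPLICITY OF THE TRANSPORTED BONDS: for a fixed position `t` on the segment, the bond `segBond c r t` determines
the coarse bond `c` and the offset `r` (standing range: `AveragingRT.blockSite_inj`).  Hence every fine bond lies on at most `L`
transported bonds `[x, x′]` — the count `L · L^{−d} = L^{1−d}` of [Balaban1985Averaging] (156)/(138) read at the flat
configuration (cell record `t4/T4-EST-O3cNE1a.md`; `T4AvgJacobianL1.card_segmentFibre_le` is the `ℤ^d` version). [folklore] -/
theorem segBond_injective (hj : j + 1 ≤ P.m + P.K) (t : ℕ) :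
    Function.Injective (fun p : PBond P (j + 1) × (Fin P.d → Fin P.L) => segBond p.1 p.2 t) := by
  rintro ⟨⟨y, μ⟩, r⟩ ⟨⟨y', μ'⟩, r'⟩ h
  simp only [segBond, PBond.mk.injEq] at h
  obtain ⟨hsite, rfl⟩ := h
  have key : ∀ z : Site P j, Function.update (Function.update z μ (z μ + t)) μ
      ((Function.update z μ (z μ + t)) μ - t) = z := by
    intro z
    rw [Function.update_idem, Function.update_self, add_sub_cancel_right, Function.update_eq_self]
  have hB : Site.blockSite y r = Site.blockSite y' r' := by
    have h2 := congrArg (fun z : Site P j => Function.update z μ (z μ - (t : ZMod (P.sitesPerDir j)))) hsite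
    simp only [key] at h2
    exact h2
  obtain ⟨rfl, rfl⟩ := blockSite_inj hj hB
  rfl

/-- … so a column sum over all transported bonds at a fixed segment position is at most the full `ℓ¹` sum. [folklore] -/
theorem sum_segBond_le (hj : j + 1 ≤ P.m + P.K) (t : ℕ) (f : PBond P j → ℝ) (hf : ∀ b, 0 ≤ f b) :
    ∑ c : PBond P (j + 1), ∑ r : Fin P.d → Fin P.L, f (segBond c r t) ≤ ∑ b : PBond P j, f b := by
  classical
  rw [← Fintype.sum_prod_type']
  calc ∑ p : PBond P (j + 1) × (Fin P.d → Fin P.L), f (segBond p.1 p.2 t)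
      = ∑ b ∈ Finset.univ.image (fun p : PBond P (j + 1) × (Fin P.d → Fin P.L) => segBond p.1 p.2 t), f b := by
        rw [Finset.sum_image fun p _ q _ hpq => segBond_injective hj t hpq]
    _ ≤ ∑ b, f b := Finset.sum_le_sum_of_subset_of_nonneg (Finset.subset_univ _) fun b _ _ => hf b

end Geometry

/-! ## §4 Bałaban's (0.4) block averaging with the EXACT logarithm: a genuine `Setup.Averaging` in the abelian model -/

section Model

variable {P : Params} {j : ℕ}

/-- `|Idx P| = L^d · |S_d × S_d|`: the index set of the double average of (0.4) (offsets × two orderings). [folklore] -/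
theorem card_idx (P : Params) : (Fintype.card (Idx P) : ℝ) =
    (P.L : ℝ) ^ P.d * (Fintype.card (Equiv.Perm (Fin P.d) × Equiv.Perm (Fin P.d)) : ℝ) := by
  rw [show Fintype.card (Idx P) = Fintype.card (Fin P.d → Fin P.L) *
      Fintype.card (Equiv.Perm (Fin P.d) × Equiv.Perm (Fin P.d)) from Fintype.card_prod _ _,
    Fintype.card_fun, Fintype.card_fin, Fintype.card_fin]
  push_cast
  ring

/-- The index set is nonempty, so its cardinality is a positive real. [folklore] -/
theorem card_idx_pos (P : Params) : (0 : ℝ) < Fintype.card (Idx P) := Nat.cast_pos.mpr Fintype.card_pos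

/-- A sum over the index set of a function of the OFFSET only is `|S_d × S_d|` times the sum over offsets. [folklore] -/
theorem sum_idx_of_fst (g : (Fin P.d → Fin P.L) → ℝ) :
    ∑ i : Idx P, g i.1 = (Fintype.card (Equiv.Perm (Fin P.d) × Equiv.Perm (Fin P.d)) : ℝ) * ∑ r, g r := by
  rw [show (∑ i : Idx P, g i.1) = ∑ r : Fin P.d → Fin P.L, ∑ _p : Equiv.Perm (Fin P.d) × Equiv.Perm (Fin P.d), g r from
    Fintype.sum_prod_type _]
  simp only [Finset.sum_const, Finset.card_univ, nsmul_eq_mul]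
  rw [Finset.mul_sum]

/-- THE EXPONENT OF (0.4) WITH THE EXACT LOGARITHM: the mean, over `x ∈ B(c₋)` (offset `r`) and the orderings `σ, σ′` of
`Γ ∈ G(c₋,x)`, `Γ′ ∈ G(c₊,x′)`, of the phases of the loop variables `U(Γ ∪ [x,x′] ∪ (−Γ′) ∪ (−c))` (tree `BlockAveraging.loopHol`) —
«Σ_{x∈B(c₋)} L^{-d} Σ_Γ |G|⁻¹ Σ_Γ′ |G|⁻¹ (1/i) log U(…)» of [Balaban1987RG1] (0.4) p. 253, the logarithm being the phase itself in
the abelian model (no small-field guard is needed: `log` is global). [folklore] -/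
def loopMean (U : GaugeField P j LinPhase) (c : PBond P (j + 1)) : ℝ :=
  (Fintype.card (Idx P) : ℝ)⁻¹ * ∑ i : Idx P, (loopHol U c i).ph

/-- **`Ū(c) = exp[i · mean (1/i) log U(loop)] · U(c)` OF [Balaban1987RG1] (0.4) IN THE ABELIAN MODEL**: the correction factor
with phase `loopMean U c` times the straight transporter `U(c)` (tree `AveragingRT.axialAvg`).  Compare the tree's
`BlockAveraging.avgFun ℰ` (any group, axiomatic small-loop average `ℰ`, guarded by `Small`): here the inner average is the exact
arithmetic mean of the phases and the map is total without a guard. [folklore] -/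
def linAvgFun (U : GaugeField P j LinPhase) : GaugeField P (j + 1) LinPhase :=
  fun c => (⟨loopMean U c⟩ : LinPhase) * axialAvg U c

/-- The exponent is GAUGE INVARIANT (loop variables based at `emb c₋` transform by conjugation, `BlockAveraging.loopHol_gaugeAct`,
and conjugation is trivial in the abelian model). [folklore] -/
theorem loopMean_gaugeAct (u : GaugeTransf P j LinPhase) (U : GaugeField P j LinPhase) (c : PBond P (j + 1)) :
    loopMean (GaugeField.gaugeAct u U) c = loopMean U c := by
  unfold loopMean
  congr 1
  refine Finset.sum_congr rfl fun i _ => ?_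
  rw [loopHol_gaugeAct]
  simp only [mul_ph, inv_ph]
  ring

/-- **COVARIANCE** `Ū^u = (Ū)^{u∘emb}` ([Balaban1985Averaging] (11), the first axiom of `Setup.Averaging`), standing range. [folklore] -/
theorem linAvgFun_covariant (hj : j + 1 ≤ P.m + P.K) (u : GaugeTransf P j LinPhase) (U : GaugeField P j LinPhase) :
    linAvgFun (GaugeField.gaugeAct u U) = GaugeField.gaugeAct (fun y => u (emb y)) (linAvgFun U) := by
  funext c
  apply LinPhase.ext
  simp only [linAvgFun, loopMean_gaugeAct, axialAvg_covariant hj, GaugeField.gaugeAct, mul_ph, inv_ph]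
  ring

/-- **LOCALITY** (the second axiom of `Setup.Averaging`): `Ū(c)` depends only on the bonds issuing from `B(c₋) ∪ B(c₊)`
(`BlockAveraging.loopHol_local`, `AveragingRT.axialAvg_local`), standing range. [folklore] -/
theorem linAvgFun_local (hj : j + 1 ≤ P.m + P.K) (U U' : GaugeField P j LinPhase) (c : PBond P (j + 1))
    (hUU' : ∀ b : PBond P j, (blockOf b.src = c.src ∨ blockOf b.src = c.tgt) → U b = U' b) :
    linAvgFun U c = linAvgFun U' c := by
  simp only [linAvgFun, loopMean, loopHol_local hj U U' c hUU', axialAvg_local hj U U' c hUU']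

/-- **THE ABELIAN (0.4) BLOCK AVERAGING AS AN INHABITANT OF `Setup.Averaging`** (total in `j` and in `U`; the two axioms supplied
in the standing range).  A GENUINE average over the `L^d` block sites — unlike the axial decimation of `AveragingRT.axial`, for
which the tree has NE1a-STEP with `θ = 1` (`QLaCriticalityAxial.avgStepContraction_axial`; a bond ON the line moves the coarse
variable one-for-one, so decimation cannot contract). [folklore] -/
def linAvg : Averaging P j LinPhase where
  avg := linAvgFun
  covariant := fun hj u U => linAvgFun_covariant hj u U
  local_dep := fun hj U U' c h => linAvgFun_local hj U U' c h

/-- `linAvg.avg = linAvgFun`. [folklore] -/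
@[simp] theorem linAvg_avg : (linAvg : Averaging P j LinPhase).avg = linAvgFun := rfl

/-- The average of the trivial configuration is trivial. [folklore] -/
theorem linAvgFun_one (c : PBond P (j + 1)) : linAvgFun (1 : GaugeField P j LinPhase) c = 1 := by
  apply LinPhase.ext
  simp [linAvgFun, loopMean, loopHol, ph_holAt_one, axialAvg_eq_holAt_walk]

/-- `AvgFlat` for the abelian block averaging (every level). [folklore] -/
theorem avgFlat_linAvg : AvgFlat (P := P) (G := LinPhase) fun k => (linAvg : Averaging P k LinPhase) := by
  intro k _
  funext c
  exact linAvgFun_one c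

end Model




end Summit.QuantumFields.BalabanUV.T4Continuum.Spine.NE7

end
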